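import Literature.MathematicalPhysics.KineticTheory.HardSphereEuler
import Mathlib.Analysis.Calculus.MeanValue
import Mathlib.Analysis.Calculus.Deriv.Inv
import Mathlib.Analysis.Analytic.Basic
import Mathlib.Analysis.Calculus.FDeriv.Analytic
import HarnessLib

/-!
# Hard-sphere local density approximation, II: calculus of the local chemical potential

Helper file for the support item `HardSphereLDA` (stmt-AtomisticToContinuum-13459) of route
`JaynesSqueeze`. Under the low-density equation of state (`HsEosLowDensity`: the excess free energy
per particle `f_ex = hsExcessFreeEnergy` agrees on `[0, η₀)` with a function `F` real-analytic on
`(−η₀, η₀)`), the item's local chemical potential of the hard-sphere gas at reduced diameter `σ`,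

  `h_σ(r) = log r + g_σ(r)`,  `g_σ(r) = f_ex(rσ³) + rσ³ f_ex′(rσ³)`,

and the local free-energy density `v_σ(r) = r · rσ³ f_ex′(rσ³)` (the integrand of clause (B1))
are smooth in `r > 0` as long as `rσ³` stays in the analyticity window. This file isolates the
ONLY calculus the local density approximation uses, with a packing threshold `η_c` and a constant
`C` depending on the equation of state alone (`eos_calculus`): for `0 < r`, `rσ³ ≤ η_c`,

* `g_σ(r) = F(rσ³) + rσ³F′(rσ³)` (the `deriv` in `g_σ` is a genuine derivative there);
* `h_σ′(r) = k(r)` with `1/(2r) ≤ k(r) ≤ 3/(2r)` (so `h_σ` is strictly increasing: the activity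
  `r e^{g_σ(r)}` is an increasing function of the density) and `|k′(r)| ≤ 1/r² + C σ⁶`;
* `v_σ′(r) = r k(r) − 1` and `|(r k(r) − 1)′| ≤ C σ³` (second-order Taylor control of `v_σ`).

Plus two generic mean-value estimates used downstream (`abs_sub_sub_mul_le_of_deriv`: second-order
Taylor remainder from a bound on the second derivative; `abs_stieltjes_remainder_le`: the
Riemann–Stieltjes remainder `|Ψ(r′) − Ψ(r) − r(h(r′) − h(r))| ≤ K|r′ − r|²` when `Ψ′ = r h′`).
No definitions. prover-pitem-stmt-AtomisticToContinuum-13459-0.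
-/

noncomputable section

namespace Summit.AtomisticToContinuum.HydrodynamicLimit.Theorems.HardSphereLDA

open MeasureTheory Filter Set Topology
open Literature.MathematicalPhysics.KineticTheory

/-! ### Two generic mean-value estimates -/

/-- **Second-order Taylor remainder from a second-derivative bound.** If `f′ = f₁` and `f₁′ = f₂`
on `[[x, y]]` with `|f₂| ≤ K` there, then `|f(y) − f(x) − f₁(x)(y − x)| ≤ K (y − x)²`. [folklore] -/
theorem abs_sub_sub_mul_le_of_deriv {f f₁ f₂ : ℝ → ℝ} {K x y : ℝ}
    (hf : ∀ s ∈ uIcc x y, HasDerivAt f (f₁ s) s) (hf₁ : ∀ s ∈ uIcc x y, HasDerivAt f₁ (f₂ s) s)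
    (hK : ∀ s ∈ uIcc x y, |f₂ s| ≤ K) :
    |f y - f x - f₁ x * (y - x)| ≤ K * (y - x) ^ 2 := by
  -- the first derivative moves by at most `K |y - x|` on the segment
  have hK0 : 0 ≤ K := (abs_nonneg _).trans (hK x left_mem_uIcc)
  have h1 : ∀ s ∈ uIcc x y, |f₁ s - f₁ x| ≤ K * |y - x| := by
    intro s hs
    have hsub : uIcc x s ⊆ uIcc x y := uIcc_subset_uIcc_left hs
    have h := Convex.norm_image_sub_le_of_norm_hasDerivWithin_le (f := f₁) (f' := f₂) (s := uIcc x s)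
      (C := K) (fun t ht => (hf₁ t (hsub ht)).hasDerivWithinAt)
      (fun t ht => by rw [Real.norm_eq_abs]; exact hK t (hsub ht)) (convex_uIcc x s)
      left_mem_uIcc right_mem_uIcc
    rw [Real.norm_eq_abs, Real.norm_eq_abs] at h
    refine h.trans (mul_le_mul_of_nonneg_left ?_ hK0)
    exact abs_sub_le_of_uIcc_subset_uIcc hsub
  -- integrate: `Θ(s) = f(s) - f(x) - f₁(x)(s - x)` has `|Θ'| ≤ K|y - x|`
  have h2 := Convex.norm_image_sub_le_of_norm_hasDerivWithin_le
    (f := fun s => f s - f x - f₁ x * (s - x)) (f' := fun s => f₁ s - f₁ x) (s := uIcc x y)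
    (C := K * |y - x|) (fun t ht => ?_) (fun t ht => ?_) (convex_uIcc x y) left_mem_uIcc right_mem_uIcc
  · simp only [sub_self, mul_zero, sub_zero, Real.norm_eq_abs] at h2
    calc |f y - f x - f₁ x * (y - x)| ≤ K * |y - x| * |y - x| := h2
      _ = K * (y - x) ^ 2 := by rw [mul_assoc, ← sq, sq_abs]
  · have hd := ((hf t ht).sub_const (f x)).sub (((hasDerivAt_id' t).sub_const x).const_mul (f₁ x))
    have he : f₁ t - f₁ x * 1 = f₁ t - f₁ x := by ring
    rw [he] at hd
    exact hd.hasDerivWithinAt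
  · rw [Real.norm_eq_abs]; exact h1 t ht
where
  /-- `|s - x| ≤ |y - x|` for `s ∈ [[x, y]]` (through `[[x, s]] ⊆ [[x, y]]`). -/
  abs_sub_le_of_uIcc_subset_uIcc {x y s : ℝ} (h : uIcc x s ⊆ uIcc x y) : |s - x| ≤ |y - x| := by
    have hs : s ∈ uIcc x y := h right_mem_uIcc
    rcases le_total x y with hxy | hxy
    · rw [uIcc_of_le hxy] at hs
      rw [abs_of_nonneg (by linarith [hs.1]), abs_of_nonneg (by linarith)]
      linarith [hs.2]
    · rw [uIcc_of_ge hxy] at hs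
      rw [abs_of_nonpos (by linarith [hs.2]), abs_of_nonpos (by linarith)]
      linarith [hs.1]

/-- **Riemann–Stieltjes remainder.** If `h′ = k` and `Ψ′(s) = s k(s)` on `[[r, r′]]` with `|k| ≤ K`
there, then `|Ψ(r′) − Ψ(r) − r (h(r′) − h(r))| ≤ K (r′ − r)²`
(`Θ(s) = Ψ(s) − Ψ(r) − r(h(s) − h(r))` has `Θ′(s) = (s − r) k(s)`). [folklore] -/
theorem abs_stieltjes_remainder_le {h Ψ k : ℝ → ℝ} {K r r' : ℝ}
    (hh : ∀ s ∈ uIcc r r', HasDerivAt h (k s) s) (hΨ : ∀ s ∈ uIcc r r', HasDerivAt Ψ (s * k s) s)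
    (hK : ∀ s ∈ uIcc r r', |k s| ≤ K) :
    |Ψ r' - Ψ r - r * (h r' - h r)| ≤ K * (r' - r) ^ 2 := by
  have hK0 : 0 ≤ K := (abs_nonneg _).trans (hK r left_mem_uIcc)
  have h2 := Convex.norm_image_sub_le_of_norm_hasDerivWithin_le
    (f := fun s => Ψ s - Ψ r - r * (h s - h r)) (f' := fun s => (s - r) * k s) (s := uIcc r r')
    (C := K * |r' - r|) (fun t ht => ?_) (fun t ht => ?_) (convex_uIcc r r') left_mem_uIcc right_mem_uIcc
  · simp only [sub_self, mul_zero, sub_zero, Real.norm_eq_abs] at h2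
    calc |Ψ r' - Ψ r - r * (h r' - h r)| ≤ K * |r' - r| * |r' - r| := h2
      _ = K * (r' - r) ^ 2 := by rw [mul_assoc, ← sq, sq_abs]
  · have hd := ((hΨ t ht).sub_const (Ψ r)).sub (((hh t ht).sub_const (h r)).const_mul r)
    have he : t * k t - r * k t = (t - r) * k t := by ring
    rw [he] at hd
    exact hd.hasDerivWithinAt
  · rw [Real.norm_eq_abs, abs_mul]
    have ht' : |t - r| ≤ |r' - r| := by
      rcases le_total r r' with hrr | hrr
      · rw [uIcc_of_le hrr] at ht
        rw [abs_of_nonneg (by linarith [ht.1]), abs_of_nonneg (by linarith)]; linarith [ht.2]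
      · rw [uIcc_of_ge hrr] at ht
        rw [abs_of_nonpos (by linarith [ht.2]), abs_of_nonpos (by linarith)]; linarith [ht.1]
    calc |t - r| * |k t| ≤ |r' - r| * K := mul_le_mul ht' (hK t ht) (abs_nonneg _) (abs_nonneg _)
      _ = K * |r' - r| := mul_comm _ _

/-! ### Bounds on the derivatives of the analytic free energy on a compact window -/

/-- An analytic `F` on `(−η₀, η₀)` has its first three derivatives bounded by one constant on
`[0, η₀/2]`, and `F`, `F′`, `F″` are differentiable there with the expected derivatives. [folklore] -/
theorem exists_deriv_bound {F : ℝ → ℝ} {η₀ : ℝ} (hη₀ : 0 < η₀) (hF : AnalyticOnNhd ℝ F (Ioo (-η₀) η₀)) :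
    ∃ C : ℝ, 0 ≤ C ∧ ∀ η ∈ Icc 0 (η₀ / 2),
      |deriv F η| ≤ C ∧ |deriv (deriv F) η| ≤ C ∧ |deriv (deriv (deriv F)) η| ≤ C ∧
      HasDerivAt F (deriv F η) η ∧ HasDerivAt (deriv F) (deriv (deriv F) η) η ∧
      HasDerivAt (deriv (deriv F)) (deriv (deriv (deriv F)) η) η := by
  have hsub : Icc 0 (η₀ / 2) ⊆ Ioo (-η₀) η₀ := fun η hη => ⟨by linarith [hη.1], by linarith [hη.2]⟩
  have hF1 : AnalyticOnNhd ℝ (deriv F) (Ioo (-η₀) η₀) := hF.deriv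
  have hF2 : AnalyticOnNhd ℝ (deriv (deriv F)) (Ioo (-η₀) η₀) := hF1.deriv
  have hF3 : AnalyticOnNhd ℝ (deriv (deriv (deriv F))) (Ioo (-η₀) η₀) := hF2.deriv
  have hcpt : IsCompact (Icc 0 (η₀ / 2)) := isCompact_Icc
  obtain ⟨C₁, hC₁⟩ := hcpt.exists_bound_of_continuousOn (hF1.continuousOn.mono hsub)
  obtain ⟨C₂, hC₂⟩ := hcpt.exists_bound_of_continuousOn (hF2.continuousOn.mono hsub)
  obtain ⟨C₃, hC₃⟩ := hcpt.exists_bound_of_continuousOn (hF3.continuousOn.mono hsub)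
  refine ⟨max (max |C₁| |C₂|) |C₃|, by positivity, fun η hη => ⟨?_, ?_, ?_, ?_, ?_, ?_⟩⟩
  · exact ((Real.norm_eq_abs _).symm.le.trans (hC₁ η hη)).trans
      ((le_abs_self _).trans ((le_max_left _ _).trans (le_max_left _ _)))
  · exact ((Real.norm_eq_abs _).symm.le.trans (hC₂ η hη)).trans
      ((le_abs_self _).trans ((le_max_right _ _).trans (le_max_left _ _)))
  · exact ((Real.norm_eq_abs _).symm.le.trans (hC₃ η hη)).trans ((le_abs_self _).trans (le_max_right _ _))
  · exact (hF η (hsub hη)).differentiableAt.hasDerivAt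
  · exact (hF1 η (hsub hη)).differentiableAt.hasDerivAt
  · exact (hF2 η (hsub hη)).differentiableAt.hasDerivAt

/-! ### The calculus package -/

-- adapted from `Literature.MathematicalPhysics.KineticTheory.deriv_hsExcessFreeEnergy_eq`
-- (HardSphereEulerLocalTheoryProofs), re-proved to keep the imports light
/-- On `(0, η₀)` the excess free energy is eventually equal to its analytic version, so its
derivative there is `F′`. [folklore] -/
theorem hsExcessFreeEnergy_eventuallyEq' {F : ℝ → ℝ} {η₀ : ℝ}
    (hEq : EqOn hsExcessFreeEnergy F (Ico 0 η₀)) {η : ℝ} (hη : η ∈ Ioo 0 η₀) :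
    hsExcessFreeEnergy =ᶠ[𝓝 η] F :=
  (eventuallyEq_of_mem (Ioo_mem_nhds hη.1 hη.2) fun _ hy => hEq ⟨hy.1.le, hy.2⟩)

/-- **THE CALCULUS OF THE LOCAL CHEMICAL POTENTIAL.** Let `f_ex = hsExcessFreeEnergy` agree on
`[0, η₀)` with `F` analytic on `(−η₀, η₀)` (`HsEosLowDensity`). There are a packing threshold
`η_c ∈ (0, η₀)` and a constant `C ≥ 0` (equation-of-state data only) such that for every `σ > 0`
there are functions `k, k₁ : ℝ → ℝ` with, for all `r > 0` with `rσ³ ≤ η_c`: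
(i) `f_ex(rσ³) = F(rσ³)` and `g_σ(r) = F(rσ³) + rσ³F′(rσ³)`;
(ii) `h_σ(r) = log r + g_σ(r)` has derivative `k(r)` with `1/(2r) ≤ k(r) ≤ 3/(2r)`;
(iii) `k` has derivative `k₁(r)` with `|k₁(r)| ≤ 1/r² + Cσ⁶`;
(iv) `v_σ(r) = r · (rσ³ f_ex′(rσ³))` has derivative `r k(r) − 1`, and `r k(r) − 1` has a derivative
of size `≤ Cσ³`. [folklore] -/
theorem eos_calculus {F : ℝ → ℝ} {η₀ : ℝ} (hη₀ : 0 < η₀) (hF : AnalyticOnNhd ℝ F (Ioo (-η₀) η₀))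
    (hEq : EqOn hsExcessFreeEnergy F (Ico 0 η₀)) :
    ∃ ηc : ℝ, 0 < ηc ∧ ηc < η₀ ∧ ∃ C : ℝ, 0 ≤ C ∧ ∀ σ : ℝ, 0 < σ →
      ∃ k k₁ : ℝ → ℝ, ∀ r : ℝ, 0 < r → r * σ ^ 3 ≤ ηc →
        hsExcessFreeEnergy (r * σ ^ 3) = F (r * σ ^ 3) ∧
        (hsExcessFreeEnergy (r * σ ^ 3) + r * σ ^ 3 * deriv hsExcessFreeEnergy (r * σ ^ 3) =
          F (r * σ ^ 3) + r * σ ^ 3 * deriv F (r * σ ^ 3)) ∧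
        HasDerivAt (fun s => Real.log s +
            (hsExcessFreeEnergy (s * σ ^ 3) + s * σ ^ 3 * deriv hsExcessFreeEnergy (s * σ ^ 3))) (k r) r ∧
        1 / (2 * r) ≤ k r ∧ k r ≤ 3 / (2 * r) ∧
        HasDerivAt k (k₁ r) r ∧ |k₁ r| ≤ 1 / r ^ 2 + C * σ ^ 6 ∧
        HasDerivAt (fun s => s * (s * σ ^ 3 * deriv hsExcessFreeEnergy (s * σ ^ 3))) (r * k r - 1) r ∧
        ∃ d : ℝ, HasDerivAt (fun s => s * k s - 1) d r ∧ |d| ≤ C * σ ^ 3 := by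
  obtain ⟨C, hC0, hC⟩ := exists_deriv_bound hη₀ hF
  -- the threshold: inside `[0, η₀/2]`, at most `1`, and `6 C η_c ≤ 1`
  set ηc : ℝ := min (min (η₀ / 4) 1) (1 / (6 * C + 1)) with hηc
  have hηc0 : 0 < ηc := lt_min (lt_min (by linarith) one_pos) (by positivity)
  have hηc1 : ηc ≤ η₀ / 4 := (min_le_left _ _).trans (min_le_left _ _)
  have hηc2 : ηc ≤ 1 := (min_le_left _ _).trans (min_le_right _ _)
  have hηc3 : ηc ≤ 1 / (6 * C + 1) := min_le_right _ _
  have hηcC : 6 * C * ηc ≤ 1 := by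
    have h1 : ηc * (6 * C + 1) ≤ 1 := by rwa [le_div_iff₀ (by positivity)] at hηc3
    nlinarith
  refine ⟨ηc, hηc0, by linarith, 7 * C, by positivity, fun σ hσ => ?_⟩
  have hσ3 : 0 < σ ^ 3 := pow_pos hσ 3
  -- the derivatives, in terms of `F`
  set k : ℝ → ℝ := fun r => 1 / r + σ ^ 3 * (2 * deriv F (r * σ ^ 3) + r * σ ^ 3 * deriv (deriv F) (r * σ ^ 3)) with hk
  set k₁ : ℝ → ℝ := fun r => -1 / r ^ 2 + (3 * σ ^ 6 * deriv (deriv F) (r * σ ^ 3) + r * σ ^ 9 * deriv (deriv (deriv F)) (r * σ ^ 3))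
    with hk₁
  refine ⟨k, k₁, fun r hr hrσ => ?_⟩
  -- the window around `r`
  have hmem : ∀ s : ℝ, 0 < s → s * σ ^ 3 ≤ ηc → s * σ ^ 3 ∈ Icc 0 (η₀ / 2) := fun s hs hsσ =>
    ⟨(mul_pos hs hσ3).le, hsσ.trans (hηc1.trans (by linarith))⟩
  have hrI : r * σ ^ 3 ∈ Icc 0 (η₀ / 2) := hmem r hr hrσ
  have hrIoo : r * σ ^ 3 ∈ Ioo 0 η₀ := ⟨mul_pos hr hσ3, by linarith [hrI.2]⟩
  obtain ⟨hb1, hb2, hb3, hd0, hd1, hd2⟩ := hC _ hrI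
  -- (i) the excess free energy and its derivative are the analytic ones at `rσ³`
  have heq0 : hsExcessFreeEnergy (r * σ ^ 3) = F (r * σ ^ 3) := hEq ⟨hrIoo.1.le, hrIoo.2⟩
  have heq1 : deriv hsExcessFreeEnergy (r * σ ^ 3) = deriv F (r * σ ^ 3) :=
    (hsExcessFreeEnergy_eventuallyEq' hEq hrIoo).deriv_eq
  -- the `g`-part as a function of `s`, eventually equal to its analytic version near `r`
  have hU : ∀ᶠ s in 𝓝 r, 0 < s ∧ s * σ ^ 3 < η₀ := by
    have h1 : ∀ᶠ s in 𝓝 r, 0 < s := lt_mem_nhds hr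
    have h2 : ∀ᶠ s in 𝓝 r, s * σ ^ 3 < η₀ := by
      have hc : Continuous fun s : ℝ => s * σ ^ 3 := continuous_id.mul continuous_const
      exact hc.continuousAt.eventually (gt_mem_nhds hrIoo.2)
    exact h1.and h2
  have hgev : (fun s => hsExcessFreeEnergy (s * σ ^ 3) + s * σ ^ 3 * deriv hsExcessFreeEnergy (s * σ ^ 3))
      =ᶠ[𝓝 r] fun s => F (s * σ ^ 3) + s * σ ^ 3 * deriv F (s * σ ^ 3) := by
    filter_upwards [hU] with s hs
    have hsI : s * σ ^ 3 ∈ Ioo 0 η₀ := ⟨mul_pos hs.1 hσ3, hs.2⟩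
    rw [hEq ⟨hsI.1.le, hsI.2⟩, (hsExcessFreeEnergy_eventuallyEq' hEq hsI).deriv_eq]
  have hvev : (fun s => s * (s * σ ^ 3 * deriv hsExcessFreeEnergy (s * σ ^ 3)))
      =ᶠ[𝓝 r] fun s => s * (s * σ ^ 3 * deriv F (s * σ ^ 3)) := by
    filter_upwards [hU] with s hs
    have hsI : s * σ ^ 3 ∈ Ioo 0 η₀ := ⟨mul_pos hs.1 hσ3, hs.2⟩
    rw [(hsExcessFreeEnergy_eventuallyEq' hEq hsI).deriv_eq]
  -- elementary derivatives at `r`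
  have hu : HasDerivAt (fun s : ℝ => s * σ ^ 3) (σ ^ 3) r := by
    simpa using (hasDerivAt_id r).mul_const (σ ^ 3)
  have hFu : HasDerivAt (fun s => F (s * σ ^ 3)) (deriv F (r * σ ^ 3) * σ ^ 3) r :=
    HasDerivAt.comp (h₂ := F) r hd0 hu
  have hF₁u : HasDerivAt (fun s => deriv F (s * σ ^ 3)) (deriv (deriv F) (r * σ ^ 3) * σ ^ 3) r :=
    HasDerivAt.comp (h₂ := deriv F) r hd1 hu
  have hF₂u : HasDerivAt (fun s => deriv (deriv F) (s * σ ^ 3))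
      (deriv (deriv (deriv F)) (r * σ ^ 3) * σ ^ 3) r :=
    HasDerivAt.comp (h₂ := deriv (deriv F)) r hd2 hu
  have huF₁ : HasDerivAt (fun s => s * σ ^ 3 * deriv F (s * σ ^ 3))
      (σ ^ 3 * deriv F (r * σ ^ 3) + r * σ ^ 3 * (deriv (deriv F) (r * σ ^ 3) * σ ^ 3)) r := hu.mul hF₁u
  have hlog : HasDerivAt Real.log (1 / r) r := by
    rw [one_div]; exact Real.hasDerivAt_log hr.ne'
  -- (ii) derivative of `h_σ`
  have hh : HasDerivAt (fun s => Real.log s +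
      (hsExcessFreeEnergy (s * σ ^ 3) + s * σ ^ 3 * deriv hsExcessFreeEnergy (s * σ ^ 3))) (k r) r := by
    have h := hlog.add (hFu.add huF₁)
    have he : 1 / r + (deriv F (r * σ ^ 3) * σ ^ 3 + (σ ^ 3 * deriv F (r * σ ^ 3) + r * σ ^ 3 * (deriv (deriv F) (r * σ ^ 3) * σ ^ 3)))
        = k r := by rw [hk]; ring
    rw [he] at h
    exact h.congr_of_eventuallyEq ((EventuallyEq.refl _ _).add hgev)
  -- bounds on `k`
  have hrσ1 : r * σ ^ 3 ≤ 1 := hrσ.trans hηc2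
  have hcorr : |σ ^ 3 * (2 * deriv F (r * σ ^ 3) + r * σ ^ 3 * deriv (deriv F) (r * σ ^ 3))| ≤ 3 * C * σ ^ 3 := by
    rw [abs_mul, abs_of_pos hσ3]
    have h1 : |2 * deriv F (r * σ ^ 3) + r * σ ^ 3 * deriv (deriv F) (r * σ ^ 3)| ≤ 3 * C := by
      calc |2 * deriv F (r * σ ^ 3) + r * σ ^ 3 * deriv (deriv F) (r * σ ^ 3)|
          ≤ |2 * deriv F (r * σ ^ 3)| + |r * σ ^ 3 * deriv (deriv F) (r * σ ^ 3)| := abs_add_le _ _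
        _ ≤ 2 * C + 1 * C := by
            gcongr
            · rw [abs_mul, abs_of_pos (by norm_num : (0 : ℝ) < 2)]
              exact mul_le_mul_of_nonneg_left hb1 (by norm_num)
            · rw [abs_mul, abs_of_pos hrIoo.1]
              exact mul_le_mul hrσ1 hb2 (abs_nonneg _) (by norm_num)
        _ = 3 * C := by ring
    nlinarith [abs_nonneg (2 * deriv F (r * σ ^ 3) + r * σ ^ 3 * deriv (deriv F) (r * σ ^ 3))]
  have h3C : 3 * C * σ ^ 3 ≤ 1 / (2 * r) := by
    -- `6 C (r σ³) ≤ 6 C η_c ≤ 1`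
    rw [le_div_iff₀ (by positivity)]
    nlinarith [mul_le_mul_of_nonneg_left hrσ (by positivity : (0 : ℝ) ≤ 6 * C)]
  have hk_lo : 1 / (2 * r) ≤ k r := by
    have h := neg_abs_le (σ ^ 3 * (2 * deriv F (r * σ ^ 3) + r * σ ^ 3 * deriv (deriv F) (r * σ ^ 3)))
    have h1 : 1 / r = 1 / (2 * r) + 1 / (2 * r) := by field_simp; ring
    rw [hk]; dsimp only; rw [h1]
    linarith
  have hk_hi : k r ≤ 3 / (2 * r) := by
    have h := le_abs_self (σ ^ 3 * (2 * deriv F (r * σ ^ 3) + r * σ ^ 3 * deriv (deriv F) (r * σ ^ 3)))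
    have h1 : 3 / (2 * r) = 1 / r + 1 / (2 * r) := by field_simp; ring
    rw [hk]; dsimp only; rw [h1]
    linarith
  -- (iii) derivative of `k`
  have hinv : HasDerivAt (fun s : ℝ => 1 / s) (-1 / r ^ 2) r := by
    have h := hasDerivAt_inv hr.ne'
    have e : -(r ^ 2)⁻¹ = -1 / r ^ 2 := by ring
    rw [e] at h
    exact h.congr_of_eventuallyEq (Eventually.of_forall fun s => one_div s)
  have hk' : HasDerivAt k (k₁ r) r := by
    have h2F₁ : HasDerivAt (fun s => 2 * deriv F (s * σ ^ 3)) (2 * (deriv (deriv F) (r * σ ^ 3) * σ ^ 3)) r := hF₁u.const_mul 2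
    have huF₂ : HasDerivAt (fun s => s * σ ^ 3 * deriv (deriv F) (s * σ ^ 3))
        (σ ^ 3 * deriv (deriv F) (r * σ ^ 3) + r * σ ^ 3 * (deriv (deriv (deriv F)) (r * σ ^ 3) * σ ^ 3)) r := hu.mul hF₂u
    have h := hinv.add ((h2F₁.add huF₂).const_mul (σ ^ 3))
    have he : -1 / r ^ 2 + σ ^ 3 * (2 * (deriv (deriv F) (r * σ ^ 3) * σ ^ 3) +
        (σ ^ 3 * deriv (deriv F) (r * σ ^ 3) + r * σ ^ 3 * (deriv (deriv (deriv F)) (r * σ ^ 3) * σ ^ 3))) = k₁ r := by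
      rw [hk₁]; ring
    rw [he] at h
    exact h
  have hk₁_bd : |k₁ r| ≤ 1 / r ^ 2 + 7 * C * σ ^ 6 := by
    rw [hk₁]; dsimp only
    have t0 : |-1 / r ^ 2| = 1 / r ^ 2 := by
      rw [abs_div, abs_neg, abs_one, abs_of_pos (pow_pos hr 2)]
    have t1 : |3 * σ ^ 6 * deriv (deriv F) (r * σ ^ 3)| ≤ 3 * σ ^ 6 * C := by
      rw [abs_mul, abs_of_pos (by positivity : (0 : ℝ) < 3 * σ ^ 6)]
      exact mul_le_mul_of_nonneg_left hb2 (by positivity)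
    have t2 : |r * σ ^ 9 * deriv (deriv (deriv F)) (r * σ ^ 3)| ≤ 1 * σ ^ 6 * C := by
      rw [abs_mul, abs_of_pos (by positivity : (0 : ℝ) < r * σ ^ 9)]
      have e : r * σ ^ 9 = (r * σ ^ 3) * σ ^ 6 := by ring
      rw [e]
      exact mul_le_mul (by nlinarith [pow_pos hσ 6]) hb3 (abs_nonneg _) (by positivity)
    calc |-1 / r ^ 2 + (3 * σ ^ 6 * deriv (deriv F) (r * σ ^ 3) + r * σ ^ 9 * deriv (deriv (deriv F)) (r * σ ^ 3))|
        ≤ |-1 / r ^ 2| + |3 * σ ^ 6 * deriv (deriv F) (r * σ ^ 3) +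
            r * σ ^ 9 * deriv (deriv (deriv F)) (r * σ ^ 3)| := abs_add_le _ _
      _ ≤ |-1 / r ^ 2| + (|3 * σ ^ 6 * deriv (deriv F) (r * σ ^ 3)| +
            |r * σ ^ 9 * deriv (deriv (deriv F)) (r * σ ^ 3)|) := by
          gcongr
          exact abs_add_le _ _
      _ ≤ 1 / r ^ 2 + (3 * σ ^ 6 * C + 1 * σ ^ 6 * C) := by rw [t0]; gcongr
      _ ≤ 1 / r ^ 2 + 7 * C * σ ^ 6 := by nlinarith [pow_pos hσ 6]
  -- (iv) the free-energy density `v_σ`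
  have hv : HasDerivAt (fun s => s * (s * σ ^ 3 * deriv hsExcessFreeEnergy (s * σ ^ 3))) (r * k r - 1) r := by
    have h := (hasDerivAt_id r).mul huF₁
    have he : 1 * (r * σ ^ 3 * deriv F (r * σ ^ 3)) +
        id r * (σ ^ 3 * deriv F (r * σ ^ 3) + r * σ ^ 3 * (deriv (deriv F) (r * σ ^ 3) * σ ^ 3)) = r * k r - 1 := by
      rw [hk]; simp only [id]; field_simp; ring
    rw [he] at h
    exact h.congr_of_eventuallyEq hvev
  have hw : HasDerivAt (fun s => s * k s - 1) (k r + r * k₁ r) r := by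
    have h := ((hasDerivAt_id r).mul hk').sub_const 1
    simpa using h
  have hw_bd : |k r + r * k₁ r| ≤ 7 * C * σ ^ 3 := by
    have he : k r + r * k₁ r = σ ^ 3 * (2 * deriv F (r * σ ^ 3) + 4 * (r * σ ^ 3) * deriv (deriv F) (r * σ ^ 3) +
        (r * σ ^ 3) ^ 2 * deriv (deriv (deriv F)) (r * σ ^ 3)) := by
      rw [hk, hk₁]; dsimp only; field_simp; ring
    rw [he, abs_mul, abs_of_pos hσ3]
    have t1 : |2 * deriv F (r * σ ^ 3)| ≤ 2 * C := by
      rw [abs_mul, abs_of_pos (by norm_num : (0 : ℝ) < 2)]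
      exact mul_le_mul_of_nonneg_left hb1 (by norm_num)
    have t2 : |4 * (r * σ ^ 3) * deriv (deriv F) (r * σ ^ 3)| ≤ 4 * 1 * C := by
      rw [abs_mul, abs_of_pos (by positivity : (0 : ℝ) < 4 * (r * σ ^ 3))]
      exact mul_le_mul (by linarith [hrσ1]) hb2 (abs_nonneg _) (by norm_num)
    have t3 : |(r * σ ^ 3) ^ 2 * deriv (deriv (deriv F)) (r * σ ^ 3)| ≤ 1 * C := by
      rw [abs_mul, abs_of_pos (by positivity : (0 : ℝ) < (r * σ ^ 3) ^ 2)]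
      exact mul_le_mul ((pow_le_one₀ hrIoo.1.le hrσ1).trans (le_refl 1)) hb3 (abs_nonneg _) (by norm_num)
    have h1 : |2 * deriv F (r * σ ^ 3) + 4 * (r * σ ^ 3) * deriv (deriv F) (r * σ ^ 3) +
        (r * σ ^ 3) ^ 2 * deriv (deriv (deriv F)) (r * σ ^ 3)| ≤ 7 * C := by
      calc |2 * deriv F (r * σ ^ 3) + 4 * (r * σ ^ 3) * deriv (deriv F) (r * σ ^ 3) +
            (r * σ ^ 3) ^ 2 * deriv (deriv (deriv F)) (r * σ ^ 3)|
          ≤ |2 * deriv F (r * σ ^ 3)| + |4 * (r * σ ^ 3) * deriv (deriv F) (r * σ ^ 3)| +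
            |(r * σ ^ 3) ^ 2 * deriv (deriv (deriv F)) (r * σ ^ 3)| := abs_add_three _ _ _
        _ ≤ 2 * C + 4 * 1 * C + 1 * C := by gcongr
        _ = 7 * C := by ring
    nlinarith [abs_nonneg (2 * deriv F (r * σ ^ 3) + 4 * (r * σ ^ 3) * deriv (deriv F) (r * σ ^ 3) +
      (r * σ ^ 3) ^ 2 * deriv (deriv (deriv F)) (r * σ ^ 3))]
  exact ⟨heq0, by rw [heq0, heq1], hh, hk_lo, hk_hi, hk', hk₁_bd, hv, k r + r * k₁ r, hw, hw_bd⟩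

end Summit.AtomisticToContinuum.HydrodynamicLimit.Theorems.HardSphereLDA

end
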